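import Summits.CriticalPhenomena.CardyFormulaZ2.Theorems.CardyBondTriangularBondTriangularCardyBlueArmCycleMain
import Summits.CriticalPhenomena.CardyFormulaZ2.Theorems.CardyBondTriangularBondTriangularCardyBlueArmCycleBump
import HarnessLib

/-!
# Route CardyBondTriangular · crux `BondTriangularCardy` · line `birth`: the blue arm of Claim 10 — the kite interface from `w` does not close up

Helper of the stub `stub_blueArm`; port of `TriClaim10Cycle.lean` (§§Bump: `false_of_contact_one`,
`false_of_contact_two`; §CycleFalse: `cyc_false`) to the kite walk (Bollobás–Riordan,
*Percolation* (2006), Ch. 7, pp. 178–179: "Suppose next that the component of `I` containing `f`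
is a cycle … Our aim is to deduce a contradiction"). With the right cells `ρ₀ = x₂` on the final
part of the yellow path and `ρ_{N-1} = x₁` on the initial part: the last anchor `r` on
`P₂ ∪ {contacts with A₂}` and the first anchor `s ≥ r` after it on `P₁ ∪ {contacts with A₁}`; the
right cells strictly between are hexagons of `G` off the path (`cyc_block_exit_two`); `r < s` is
the main case (`cyc_main_false`), `r = s` the degenerate contacts (bumps of the path against the
boundary, `false_of_bump`; or a hexagon off the path touching `A₁` below `u` and `A₂` beyond `v`,
`false_of_two_sided`).

## References

* B. Bollobás, O. Riordan, *Percolation*, CUP (2006), Ch. 7, Claim 10 pp. 178–179.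
-/

namespace Summit.CriticalPhenomena.CardyFormulaZ2.Theorems.BondTriangularCardyLine.KiteB

open Finset Literature.Probability.Percolation Literature.Probability.LatticeModels

/-- **The last site of a list split as `A ++ B` is the last site of `B`** (registered anchor of this
file). -/
theorem getLast_eq_of_eq_append : ∀ {A B l : List (Literature.Probability.LatticeModels.Site 2)} (hB : B ≠ []) (hl : l ≠ []), l = A ++ B → B.getLast hB = l.getLast hl := by
  intro A B l hB hl h; subst h; exact (List.getLast_append_of_right_ne_nil _ _ hB).symm

/-- The first site of a list split as `A ++ B`, `A ≠ []`, is the first site of `A`. -/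
theorem head_eq_of_eq_append {A B l : List (Site 2)} (hA : A ≠ []) (hl : l ≠ []) (h : l = A ++ B) :
    A.head hA = l.head hl := by
  subst h; exact (List.head_append_of_ne_nil hA).symm

section End

variable (D : TriMarkedDomain 3) {σ : CLHexConfig} {w : HexVertex}
  (hnotw : ∀ (Q' : List (Site 2)) (hne : Q' ≠ []), Q'.Nodup → List.IsChain triGraph.Adj Q' →
    (∀ s ∈ Q', s ∈ D.verts ∧ σ s ≠ CLHexState.B) → (∀ d ∈ pathDarts Q', (clYellowGraph σ).Adj d.1 d.2) →
    ∀ nu' nv' : ℕ, D.pos 1 ≤ nu' → nu' < D.pos 2 → D.pos 2 ≤ nv' → nv' < #(triBdryDarts D.verts) →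
    Q'.head hne = (triBdryIter D.verts D.base nu').1 → YellowTowards σ (triBdryIter D.verts D.base nu') →
    Q'.getLast hne = (triBdryIter D.verts D.base nv').1 → YellowTowards σ (triBdryIter D.verts D.base nv') →
    ¬ Separates D.verts {e : Sym2 (Site 2) | ∃ d ∈ pathDarts Q', e = s(d.1, d.2)} w (D.stretch 0))
  {Q L₁ L₂ : List (Site 2)} {a b : Site 2} (hQeq : Q = L₁ ++ a :: b :: L₂) (hQnd : Q.Nodup)
  (hQch : List.IsChain triGraph.Adj Q) (hQG : ∀ s ∈ Q, s ∈ D.verts) (hQB : ∀ s ∈ Q, σ s ≠ CLHexState.B)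
  (hQY : ∀ d ∈ pathDarts Q, (clYellowGraph σ).Adj d.1 d.2)
  {nu nv : ℕ} (hnu1 : D.pos 1 ≤ nu) (hnu2 : nu < D.pos 2) (hnv2 : D.pos 2 ≤ nv) (hnvL : nv < #(triBdryDarts D.verts))
  (hQhead : Q.head (by rw [hQeq]; simp) = (triBdryIter D.verts D.base nu).1)
  (hYu : YellowTowards σ (triBdryIter D.verts D.base nu))
  (hQlast : Q.getLast (by rw [hQeq]; simp) = (triBdryIter D.verts D.base nv).1)
  (hYv : YellowTowards σ (triBdryIter D.verts D.base nv))
  (hC : IsTriLoop (D.chordLoop Q nv (nu + #(triBdryDarts D.verts) - nv)))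
  (hπw : faceLabel (cycDarts (D.chordLoop Q nv (nu + #(triBdryDarts D.verts) - nv))) w =
    leftLabel (D.chordLoop Q nv (nu + #(triBdryDarts D.verts) - nv)))
  (hw : leftFace a b = w)

include hnotw hQnd hQch hQG hQB hQY hnu1 hnu2 hnv2 hnvL hQhead hQlast hYv hC hπw hw in
/-- **Degenerate contact with `A₁`** (`TriClaim10Cycle.false_of_contact_one`): the path's final
part `x₂ ⋯ v` passes through a hexagon `c`, yellow towards the outer head of a boundary dart of
`A₁` at a position `n' < nᵤ`; the final part from `c` is a yellow path and the initial part up to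
`c` a bump, closed by the heads over `[n', nᵤ]` to a loop with all faces of `A₀` on its right. -/
theorem false_of_contact_one {c : Site 2} (hcQ : c ∈ b :: L₂) {n' : ℕ} (hn'1 : D.pos 1 ≤ n') (hn'u : n' < nu)
    (hct : (triBdryIter D.verts D.base n').1 = c) (hYc : YellowTowards σ (triBdryIter D.verts D.base n')) : False := by
  -- adapted from `TriClaim10Cycle.false_of_contact_one` (site version)
  set L := #(triBdryDarts D.verts) with hL
  have hQne : Q ≠ [] := by rw [hQeq]; simp
  have h12 := D.pos_lt_pos₃ (show (1 : Fin 3) < 2 by decide)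
  have hL3 := D.three_le_card 0
  obtain ⟨T₂, T', hsplit⟩ := List.append_of_mem hcQ
  set B := L₁ ++ [a] ++ T₂ ++ [c] with hBdef
  have hQ3 : Q = (L₁ ++ [a] ++ T₂) ++ [c] ++ T' := by rw [hQeq, show a :: b :: L₂ = [a] ++ (b :: L₂) from rfl, hsplit]; simp
  have hQBP : Q = (L₁ ++ [a] ++ T₂) ++ (c :: T') := by rw [hQ3]; simp
  have hBne : B ≠ [] := by simp [hBdef]
  have hP₀ne : (c :: T') ≠ [] := List.cons_ne_nil _ _
  have hE : ∀ e : Sym2 (Site 2), (∃ d ∈ pathDarts Q, e = s(d.1, d.2)) ↔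
      (∃ d ∈ pathDarts B, e = s(d.1, d.2)) ∨ (∃ d ∈ pathDarts (c :: T'), e = s(d.1, d.2)) := by
    intro e
    rw [hQ3, TriMarkedDomain.exists_mem_pathDarts_three_iff (List.cons_ne_nil c [])]
    simp only [List.head_cons, List.getLast_singleton, pathDarts_singleton, List.not_mem_nil, false_and,
      exists_false, false_or]
    rfl
  -- `(c :: T')` is a yellow path from `c ∈ A₁` to `v`
  have hP₀nd : (c :: T').Nodup := (List.nodup_append.1 (hQBP ▸ hQnd)).2.1
  have hP₀ch : List.IsChain triGraph.Adj (c :: T') := (hQBP ▸ hQch).right_of_append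
  have hP₀GB : ∀ s ∈ (c :: T'), s ∈ D.verts ∧ σ s ≠ CLHexState.B := fun s hs =>
    ⟨hQG s (by rw [hQBP]; exact List.mem_append_right _ hs), hQB s (by rw [hQBP]; exact List.mem_append_right _ hs)⟩
  have hP₀Y : ∀ d ∈ pathDarts (c :: T'), (clYellowGraph σ).Adj d.1 d.2 := fun d hd =>
    hQY d (by rw [hQBP]; exact pathDarts_subset_of_suffix hP₀ne hd)
  have hP₀last : (c :: T').getLast hP₀ne = (triBdryIter D.verts D.base nv).1 := by
    have e : (c :: T').getLast hP₀ne = Q.getLast hQne := getLast_eq_of_eq_append hP₀ne hQne hQBP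
    rw [e, hQlast]
  have hns := hnotw (c :: T') hP₀ne hP₀nd hP₀ch hP₀GB hP₀Y n' nv hn'1 (by omega) hnv2 hnvL (by simpa using hct.symm) hYc
    hP₀last hYv
  -- the bump `B` and its chord loop
  have hBnd : B.Nodup := by
    have : Q = B ++ T' := by rw [hQ3]
    exact (List.nodup_append.1 (this ▸ hQnd)).1
  have hBch : List.IsChain triGraph.Adj B := by
    have : Q = B ++ T' := by rw [hQ3]
    exact (this ▸ hQch).left_of_append
  have hBG : ∀ s ∈ B, s ∈ D.verts := fun s hs => hQG s (by rw [hQ3]; exact List.mem_append_left _ hs)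
  have hBlast : B.getLast hBne = (triBdryIter D.verts D.base (n' + L)).1 := by
    rw [D.iter_add_card, hct]; simp [hBdef]
  have hBhead : B.head hBne = (triBdryIter D.verts D.base (n' + L + (nu - n'))).1 := by
    rw [show n' + L + (nu - n') = nu + L by omega, D.iter_add_card, ← hQhead]
    exact head_eq_of_eq_append hBne hQne (by rw [hQ3])
  have hB2 : 2 ≤ B.length := by simp [hBdef]; omega
  have hHnd : (D.headsList (n' + L) (nu - n')).Nodup :=
    D.headsList_nodup (m := n' + L) (N := nu - n') (c := D.pos 2 + (L - 1)) (by omega) (by omega)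
      (D.bdryHead_markPos_pred_ne 2) le_rfl
  have hPl : IsTriLoop (D.chordLoop B (n' + L) (nu - n')) :=
    D.isTriLoop_chordLoop hBne hBnd hBch hBG hB2 hBlast hBhead hHnd
  have htarget : ∀ F : HexVertex, (∃ d ∈ D.stretch 0, d.1 ∈ hexFaceVertices F ∧ d.2 ∈ hexFaceVertices F) →
      faceLabel (cycDarts (D.chordLoop B (n' + L) (nu - n'))) F = leftLabel (D.chordLoop B (n' + L) (nu - n')) + 1 := by
    intro F hF
    obtain ⟨p, hp, hFp⟩ := D.exists_eq_leftFace_of_stretch_zero hF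
    have hγ := fun q (h1 : nu ≤ q) (h2 : q + 1 ≤ n' + L) =>
      D.faceLabel_eq_leftLabel_add_one_of_mem_Ico hBne hBG (nu := nu) (nv := n' + L) (len := nu - n')
        (by omega) (by omega) (by omega) hBlast hBhead hPl h1 h2
    have hnuL : nu ≤ L - 1 := by have := D.pos_lt 2; omega
    rcases hFp with rfl | rfl
    · exact hγ (p + L) (by omega) (by omega)
    · exact hγ (p + L - 1) (by omega) (by omega)
  have hab : (a, b) ∈ pathDarts B := by
    have : B = L₁ ++ a :: b :: (T₂ ++ [c]).tail := by
      rw [hBdef]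
      cases T₂ with
      | nil =>
        have : b = c := by simpa using (congrArg List.head? hsplit)
        simp [this]
      | cons t ts =>
        have : t = b := by simpa using (congrArg List.head? hsplit).symm
        simp [this]
    rw [this]
    exact TriMarkedDomain.mem_pathDarts_append_cons_cons _ _ _ _
  exact false_of_bump D hQne hQG hnu1 hnu2 hnv2 hnvL hC hπw hBne hE hns hPl htarget hab hw

include hnotw hQnd hQch hQG hQB hQY hnu1 hnu2 hnv2 hnvL hQhead hYu hQlast hC hπw hw in
/-- **Degenerate contact with `A₂`** (`TriClaim10Cycle.false_of_contact_two`): the path's initial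
part `u ⋯ x₁` passes through a hexagon `c`, yellow towards the outer head of a boundary dart of
`A₂` at a position `n'' > nᵥ`; the initial part up to `c` is a yellow path and the final part
from `c` a bump. -/
theorem false_of_contact_two {c : Site 2} (hcQ : c ∈ L₁ ++ [a]) {n'' : ℕ} (hn''v : nv < n'')
    (hn''L : n'' < #(triBdryDarts D.verts)) (hct : (triBdryIter D.verts D.base n'').1 = c)
    (hYc : YellowTowards σ (triBdryIter D.verts D.base n'')) : False := by
  -- adapted from `TriClaim10Cycle.false_of_contact_two` (site version)
  set L := #(triBdryDarts D.verts) with hL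
  have hQne : Q ≠ [] := by rw [hQeq]; simp
  have h12 := D.pos_lt_pos₃ (show (1 : Fin 3) < 2 by decide)
  have h01 := D.pos_lt_pos₃ (show (0 : Fin 3) < 1 by decide)
  have hL3 := D.three_le_card 0
  obtain ⟨A', A₂, hsplit⟩ := List.append_of_mem hcQ
  set B := c :: (A₂ ++ b :: L₂) with hBdef
  have hQ3 : Q = A' ++ [c] ++ (A₂ ++ b :: L₂) := by
    rw [hQeq, show L₁ ++ a :: b :: L₂ = (L₁ ++ [a]) ++ (b :: L₂) by simp, hsplit]; simp
  have hQPB : Q = A' ++ B := by rw [hQ3]; simp [hBdef]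
  have hBne : B ≠ [] := List.cons_ne_nil _ _
  have hP₀ne : A' ++ [c] ≠ [] := by simp
  have hE : ∀ e : Sym2 (Site 2), (∃ d ∈ pathDarts Q, e = s(d.1, d.2)) ↔
      (∃ d ∈ pathDarts B, e = s(d.1, d.2)) ∨ (∃ d ∈ pathDarts (A' ++ [c]), e = s(d.1, d.2)) := by
    intro e
    rw [hQ3, TriMarkedDomain.exists_mem_pathDarts_three_iff (List.cons_ne_nil c [])]
    simp only [List.head_cons, List.getLast_singleton, pathDarts_singleton, List.not_mem_nil, false_and,
      exists_false, false_or]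
    rw [or_comm]
  have hP₀nd : (A' ++ [c]).Nodup := by
    have : Q = (A' ++ [c]) ++ (A₂ ++ b :: L₂) := by rw [hQ3]
    exact (List.nodup_append.1 (this ▸ hQnd)).1
  have hP₀ch : List.IsChain triGraph.Adj (A' ++ [c]) := by
    have : Q = (A' ++ [c]) ++ (A₂ ++ b :: L₂) := by rw [hQ3]
    exact (this ▸ hQch).left_of_append
  have hP₀GB : ∀ s ∈ A' ++ [c], s ∈ D.verts ∧ σ s ≠ CLHexState.B := fun s hs =>
    ⟨hQG s (by rw [hQ3]; exact List.mem_append_left _ hs), hQB s (by rw [hQ3]; exact List.mem_append_left _ hs)⟩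
  have hP₀Y : ∀ d ∈ pathDarts (A' ++ [c]), (clYellowGraph σ).Adj d.1 d.2 := fun d hd =>
    hQY d (by rw [hQ3]; exact pathDarts_subset_of_prefix hP₀ne hd)
  have hP₀head : (A' ++ [c]).head hP₀ne = (triBdryIter D.verts D.base nu).1 := by
    have e : (A' ++ [c]).head hP₀ne = Q.head hQne := head_eq_of_eq_append hP₀ne hQne (by rw [hQ3])
    rw [e, hQhead]
  have hP₀last : (A' ++ [c]).getLast hP₀ne = (triBdryIter D.verts D.base n'').1 := by
    rw [List.getLast_append_of_right_ne_nil _ _ (List.cons_ne_nil _ _), List.getLast_singleton, hct]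
  have hns := hnotw (A' ++ [c]) hP₀ne hP₀nd hP₀ch hP₀GB hP₀Y nu n'' hnu1 hnu2 (by omega) hn''L hP₀head hYu hP₀last hYc
  have hBnd : B.Nodup := (List.nodup_append.1 (hQPB ▸ hQnd)).2.1
  have hBch : List.IsChain triGraph.Adj B := (hQPB ▸ hQch).right_of_append
  have hBG : ∀ s ∈ B, s ∈ D.verts := fun s hs => hQG s (by rw [hQPB]; exact List.mem_append_right _ hs)
  have hBlast : B.getLast hBne = (triBdryIter D.verts D.base (nv + L)).1 := by
    rw [D.iter_add_card, ← hQlast]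
    exact getLast_eq_of_eq_append hBne hQne hQPB
  have hBhead : B.head hBne = (triBdryIter D.verts D.base (nv + L + (n'' - nv))).1 := by
    rw [show nv + L + (n'' - nv) = n'' + L by omega, D.iter_add_card, hct]; rfl
  have hB2 : 2 ≤ B.length := by simp [hBdef]; omega
  have hHnd : (D.headsList (nv + L) (n'' - nv)).Nodup := by
    refine D.headsList_nodup (m := nv + L) (N := n'' - nv) (c := (L - 1) + L) (by omega) (by omega) ?_ le_rfl
    have := D.bdryHead_markPos_pred_ne 0
    have hz : D.pos 0 = 0 := D.pos_zero (by decide)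
    rw [hz, zero_add] at this
    rwa [show L - 1 + L + 1 = (L - 1 + 1) + L by omega, D.bdryHead_add_card, D.bdryHead_add_card]
  have hPl : IsTriLoop (D.chordLoop B (nv + L) (n'' - nv)) :=
    D.isTriLoop_chordLoop hBne hBnd hBch hBG hB2 hBlast hBhead hHnd
  have htarget : ∀ F : HexVertex, (∃ d ∈ D.stretch 0, d.1 ∈ hexFaceVertices F ∧ d.2 ∈ hexFaceVertices F) →
      faceLabel (cycDarts (D.chordLoop B (nv + L) (n'' - nv))) F = leftLabel (D.chordLoop B (nv + L) (n'' - nv)) + 1 := by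
    intro F hF
    obtain ⟨p, hp, hFp⟩ := D.exists_eq_leftFace_of_stretch_zero hF
    have hγ := fun q (h1 : n'' ≤ q) (h2 : q + 1 ≤ nv + L) =>
      D.faceLabel_eq_leftLabel_add_one_of_mem_Ico hBne hBG (nu := n'') (nv := nv + L) (len := n'' - nv)
        (by omega) (by omega) (by omega) hBlast hBhead hPl h1 h2
    have hp1 : p + 1 ≤ nv := by omega
    rcases hFp with rfl | rfl
    · exact hγ (p + L) (by omega) (by omega)
    · exact hγ (p + L - 1) (by omega) (by omega)
  have hab : (a, b) ∈ pathDarts B := by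
    have hlastc : (c :: A₂).getLast (List.cons_ne_nil _ _) = a := by
      have : (L₁ ++ [a]).getLast (by simp) = (A' ++ c :: A₂).getLast (by simp) := by simp only [hsplit]
      rw [List.getLast_append_of_right_ne_nil _ _ (List.cons_ne_nil _ _)] at this
      simpa using this.symm
    have hca : c :: A₂ = (c :: A₂).dropLast ++ [a] := by
      rw [← hlastc]; exact (List.dropLast_append_getLast (List.cons_ne_nil _ _)).symm
    have : B = (c :: A₂).dropLast ++ a :: b :: L₂ := by
      rw [hBdef, show c :: (A₂ ++ b :: L₂) = (c :: A₂) ++ (b :: L₂) by simp]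
      conv_lhs => rw [hca]
      simp
    rw [this]
    exact TriMarkedDomain.mem_pathDarts_append_cons_cons _ _ _ _
  exact false_of_bump D hQne hQG hnu1 hnu2 hnv2 hnvL hC hπw hBne hE hns hPl htarget hab hw

end End

end Summit.CriticalPhenomena.CardyFormulaZ2.Theorems.BondTriangularCardyLine.KiteB
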